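import Mathlib
import HarnessLib

/-!
# First-birth lemma: one-signedness along a continuous path is lost only through a zero

pub-rhpf PF seat (mechanism search; **no RH claim**).  The CHANNELS sentence of `PF.md` §14.9 made a theorem of
elementary topology.  Let `X` be a compact space (the rescaled window `[-1, 1]`, so that all windows live on one
space) and `a ↦ u a ∈ C(X, ℝ)` a path of (rescaled, normalised) ground states, continuous in the sup norm on
`[a₀, ∞)` — continuity of the path is exactly where channel (M) (loss of simplicity / mode switching) is excluded.
If `u a₀ > 0` everywhere and one-signedness fails at some later window, then there is a FIRST BIRTH window
`b > a₀`: all earlier windows are strictly one-signed, `u b ≥ 0`, and `u b` has a zero `x₀` — at the edge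
(channel (E): the edge trace vanishes, hence a critical window under the edge law of `…EdgeChannel`) or in the
interior (channel (I)).  Contrapositive (`forall_pos_of_noBirth`): no nonnegative-with-a-zero state along the path
⇒ every window is one-signed; this is the concrete form of the hypotheses `hup`/`hlim` of
`evenOneSignedWindows_of_continuityRoute`.

* `isOpen_setOf_forall_pos` : `{f : C(X,ℝ) | ∀ x, 0 < f x}` is open (compactness);
* `exists_firstBirth` : the first-birth window;
* `forall_pos_of_noBirth` : the contrapositive used by the continuity route.
-/

set_option linter.unusedVariables false
set_option linter.dupNamespace false

namespace Summit.RiemannHypothesis.RiemannHypothesis.Theorems.PolarPerronFrobenius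

open Set

variable {X : Type*} [TopologicalSpace X] [CompactSpace X]

/-- On a compact space the strictly positive continuous functions form an open set of `C(X, ℝ)`. -/
theorem isOpen_setOf_forall_pos : IsOpen {f : C(X, ℝ) | ∀ x, 0 < f x} := by
  rw [Metric.isOpen_iff]
  intro f hf
  rcases isEmpty_or_nonempty X with hX | hX
  · exact ⟨1, one_pos, fun g _ x => (IsEmpty.false x).elim⟩
  · obtain ⟨x₀, -, hx₀⟩ :=
      isCompact_univ.exists_isMinOn univ_nonempty (map_continuous f).continuousOn
    refine ⟨f x₀, hf x₀, fun g hg x => ?_⟩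
    rw [Metric.mem_ball] at hg
    have h1 : dist (g x) (f x) ≤ dist g f := ContinuousMap.dist_apply_le_dist x
    have h2 : f x₀ ≤ f x := hx₀ (mem_univ x)
    rw [Real.dist_eq] at h1
    have h3 := (abs_lt.mp (lt_of_le_of_lt h1 hg)).1
    show 0 < g x
    linarith

/-- FIRST-BIRTH LEMMA.  A sup-norm-continuous path of continuous functions on a compact space that starts strictly
positive and later fails to be strictly positive has a first failure window `b > a₀`, at which the function is
nonnegative with a zero, all earlier windows being strictly positive. -/
theorem exists_firstBirth (u : ℝ → C(X, ℝ)) (a₀ : ℝ) (hu : ContinuousOn u (Ici a₀))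
    (h0 : ∀ x, 0 < u a₀ x) (hfail : ∃ a₁, a₀ ≤ a₁ ∧ ∃ x, u a₁ x ≤ 0) :
    ∃ b, a₀ < b ∧ (∀ a, a₀ ≤ a → a < b → ∀ x, 0 < u a x) ∧ (∀ x, 0 ≤ u b x) ∧ ∃ x₀, u b x₀ = 0 := by
  set S : Set ℝ := Ici a₀ ∩ u ⁻¹' {f : C(X, ℝ) | ∀ x, 0 < f x}ᶜ with hSdef
  obtain ⟨a₁, ha₁, x₁, hx₁⟩ := hfail
  have hS_ne : S.Nonempty := ⟨a₁, ha₁, fun h => absurd (h x₁) (not_lt.mpr hx₁)⟩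
  have hS_bdd : BddBelow S := ⟨a₀, fun a ha => ha.1⟩
  have hS_closed : IsClosed S :=
    hu.preimage_isClosed_of_isClosed isClosed_Ici isOpen_setOf_forall_pos.isClosed_compl
  set b := sInf S with hbdef
  have hb_mem : b ∈ S := hS_closed.csInf_mem hS_ne hS_bdd
  have hb_ge : a₀ ≤ b := hb_mem.1
  have hb_not : ¬ ∀ x, 0 < u b x := hb_mem.2
  -- earlier windows are strictly positive
  have hstep1 : ∀ a, a₀ ≤ a → a < b → ∀ x, 0 < u a x := by
    intro a ha hab
    by_contra hneg
    have haS : a ∈ S := ⟨ha, hneg⟩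
    have := csInf_le hS_bdd haS
    linarith
  -- b > a₀
  have hb_gt : a₀ < b := by
    refine lt_of_le_of_ne hb_ge (fun heq => hb_not ?_)
    rw [← heq]; exact h0
  -- u b ≥ 0 by continuity from the left
  have hstep4 : ∀ x, 0 ≤ u b x := by
    intro x
    by_contra hneg
    have hlt : u b x < 0 := lt_of_not_ge hneg
    have hcw : ContinuousWithinAt (fun a => u a x) (Ici a₀) b :=
      ((continuous_eval_const (F := C(X, ℝ)) x).continuousAt).comp_continuousWithinAt (hu b hb_ge)
    have hmem : (fun a => u a x) ⁻¹' Iio 0 ∈ nhdsWithin b (Ici a₀) :=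
      hcw.preimage_mem_nhdsWithin (Iio_mem_nhds hlt)
    obtain ⟨ε, hε, hball⟩ := Metric.mem_nhdsWithin_iff.mp hmem
    set a := max a₀ (b - ε / 2) with hadef
    have ha0 : a₀ ≤ a := le_max_left _ _
    have hab : a < b := max_lt hb_gt (by linarith)
    have haball : a ∈ Metric.ball b ε ∩ Ici a₀ := by
      refine ⟨?_, ha0⟩
      rw [Metric.mem_ball, Real.dist_eq, abs_lt]
      constructor
      · have : b - ε / 2 ≤ a := le_max_right _ _
        linarith
      · linarith
    have hneg' : u a x < 0 := hball haball
    have hpos := hstep1 a ha0 hab x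
    linarith
  refine ⟨b, hb_gt, hstep1, hstep4, ?_⟩
  obtain ⟨x₀, hx₀⟩ := not_forall.mp hb_not
  exact ⟨x₀, le_antisymm (not_lt.mp hx₀) (hstep4 x₀)⟩

/-- The contrapositive used by the continuity route: along a continuous path that starts one-signed, if NO
window carries a nonnegative state with a zero (no birth through channel (E) or (I); channel (M) being the
continuity of the path), then every window is one-signed. -/
theorem forall_pos_of_noBirth (u : ℝ → C(X, ℝ)) (a₀ : ℝ) (hu : ContinuousOn u (Ici a₀))
    (h0 : ∀ x, 0 < u a₀ x)
    (hno : ∀ b, a₀ < b → (∀ x, 0 ≤ u b x) → ∀ x, u b x ≠ 0) :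
    ∀ a, a₀ ≤ a → ∀ x, 0 < u a x := by
  intro a ha x
  by_contra hneg
  obtain ⟨b, hb, -, hnonneg, x₀, hx₀⟩ :=
    exists_firstBirth u a₀ hu h0 ⟨a, ha, x, not_lt.mp hneg⟩
  exact hno b hb hnonneg x₀ hx₀

end Summit.RiemannHypothesis.RiemannHypothesis.Theorems.PolarPerronFrobenius
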